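import Summits.AtomisticToContinuum.HydrodynamicLimit.Theorems.BoxDissipativeWeakStrongRelativeEnergyStabilityGronwallIntegrablePieces
import Summits.AtomisticToContinuum.HydrodynamicLimit.Theorems.BoxDissipativeWeakStrongRelativeEnergyStabilityGronwallAeDistinct
import Summits.AtomisticToContinuum.HydrodynamicLimit.Theorems.BoxDissipativeWeakStrongFluxClosureBoxIntegrableAlongFlow
import HarnessLib

/-!
# Crux `RelativeEnergyStability` (stmt-AtomisticToContinuum-17653), line `registered`, heart stub S-X — part 8a:
# the PATHWISE clamped relative-energy inequality — decomposition, piece identification, integrated master inequality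

For a good datum `z` of the hard-sphere flow whose orbit has pairwise distinct velocities at every rational time
(a `P_N`-full set, `sx_ae_rational_distinct`), a window `0 < l ≤ 1`, a guarded classical solution read through the cut
law (hypothesis conjunction `S` of `…GronwallStrong`), clamps `a ≤ b` and a time `t < T`, the pathwise clamped box
relative energy `e(s) = ∫ ℰ_Z(Û(Φ_s z) | (ρ,u,θ)(s,·)) dx` satisfies
`e(t) − e(0) ≤ C ∫_{(0,t]} e(s) ds + |K1-defect(t)| + (K2-defect(t))⁺`
(`sx_pathwise`), given the exact box balance laws (`BoxBalanceLawsFor`) and a pointwise master inequality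
`reducedRHS ≤ C ℰ_Z` valid at vacuum / hot / small-frozen box states (supplied by the expectation layer from
`CutEosMasterFor` and `sx_reduced_le_frozen`). This is Březina–Feireisl §3.2 with zero defect, pathwise: decompose
`ℰ_Z = Ê − m̂·u + ρ̂φ₁ − θ ρ̂ Z(ŝ) + p_cut` (`sx_clampedRelEnergy_box`), use energy conservation, the exact continuity
equation tested with `φ₁`, the pressure FTC, the K1/K2 defects for `∫m̂·u` and `∫θρ̂Z(ŝ)`, then
`−momI + contI − entI + pt = rawRHS = reducedRHS − div(pU)` and `∫ div(pU) = 0`.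
-/

noncomputable section

namespace Summit.AtomisticToContinuum.HydrodynamicLimit.Theorems.RES

open MeasureTheory Filter Set Function
open scoped Topology InnerProductSpace ENNReal
open Summit.AtomisticToContinuum.HydrodynamicLimit.Theses.BoxDissipativeWeakStrong
open Literature.MathematicalPhysics.KineticTheory Literature.Analysis.FluidPDE Literature.Analysis.FunctionSpaces
open Literature.Analysis.FluidPDE.CompressibleEuler
open Literature.Analysis.FluidPDE.CompressibleEuler.EulerPhase
open Literature.Analysis.FluidPDE.CompressibleEuler.StrongPointData

section Pathwise

variable {η₀ η₁ η₁B σ T : ℝ} {F χ f : ℝ → ℝ} {ρ θ : ℝ → T3 → ℝ} {u : ℝ → T3 → V3}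

variable (S : AnalyticOnNhd ℝ F (Ioo (-η₀) η₀) ∧ EqOn hsExcessFreeEnergy F (Ico 0 η₀) ∧ 0 < η₁ ∧ η₁ ≤ η₁B ∧
  2 * η₁B < η₀ ∧ 0 < σ ∧
  (∀ x, 0 < x → x * σ ^ 3 ≤ η₁B → f x = hsExcessFreeEnergy (x * σ ^ 3) ∧ χ x = hsCompressibility (x * σ ^ 3)) ∧
  (EulerEOS.monatomicExcess χ f).IsGibbs ∧ IsHardSphereEulerSolution σ T ρ u θ ∧
  ∀ t ∈ Ico 0 T, ∀ x, ρ t x * σ ^ 3 ≤ η₁ / 2)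
include S

/-- Continuity of the time-`s` slices of the strong data used in the decomposition (`u`, `θ`, `φ₁`, `p_cut(ρ,θ)`). -/
theorem sx_slices_continuous {s : ℝ} (hs : s ∈ Ico 0 T) :
    Continuous (u s) ∧ Continuous (θ s) ∧ Continuous (energyTestFunction (cutEOS σ η₁) ρ u θ s) ∧
      Continuous fun x => (cutEOS σ η₁).p (ρ s x) (θ s x) := by
  have hsol := S.2.2.2.2.2.2.2.2.1
  refine ⟨(hsol.smooth_velocity.isSmooth_slice hs).continuous, (hsol.smooth_temperature.isSmooth_slice hs).continuous,
    ((sx_energyTest_smooth S).isSmooth_slice hs).continuous, ?_⟩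
  exact tz_continuous_p S.1 S.2.1 S.2.2.1 (sx_band_lt S) S.2.2.2.2.2.1 (hsol.smooth_density.isSmooth_slice hs).continuous
    (hsol.smooth_temperature.isSmooth_slice hs).continuous (fun x => (sx_band S hs x).1)

/-- **Decomposition of the pathwise clamped energy** at a time `s ∈ [0,T)`:
`e(s) = ∫Ê − ∫m̂·u + ∫ρ̂φ₁ − ∫θρ̂Z(ŝ) + ∫p_cut(ρ,θ)`. -/
theorem sx_obs_decomp {N : ℕ}
    (Φ : HardSphereFlow (Literature.Analysis.FluidPDE.Torus.geometry (Fin 3)) (hsDiameter σ N) (N + 1))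
    (l a b : ℝ) (z : Config (N + 1) (Fin 3) T3) {s : ℝ} (hs : s ∈ Ico 0 T) :
    clampedRelEnergyObs σ η₁ a b ρ u θ N Φ l s z =
      (∫ x, (boxState l (Φ.flow s z) x).2.2) -
        (∫ x, inner ℝ (boxState l (Φ.flow s z) x).2.1 (u s x)) +
        (∫ x, (boxState l (Φ.flow s z) x).1 * energyTestFunction (cutEOS σ η₁) ρ u θ s x) -
        (∫ x, (boxState l (Φ.flow s z) x).1 *
            max a (min ((cutEOS σ η₁).s (boxState l (Φ.flow s z) x).1
              (2 / 3 * ((boxState l (Φ.flow s z) x).2.2 / (boxState l (Φ.flow s z) x).1 -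
                ‖(boxState l (Φ.flow s z) x).2.1‖ ^ 2 / (2 * (boxState l (Φ.flow s z) x).1 ^ 2)))) b) * θ s x) +
        ∫ x, (cutEOS σ η₁).p (ρ s x) (θ s x) := by
  obtain ⟨hu, hθ, hφ, hp⟩ := sx_slices_continuous S hs
  set w := Φ.flow s z with hw
  have h1 : Integrable (fun x => (boxState l w x).2.2) := ip_integrable_boxFun w (G := fun _ V => V.2.2) fun V => by fun_prop
  have h2 : Integrable (fun x => inner ℝ (boxState l w x).2.1 (u s x)) :=
    ip_integrable_boxFun w (G := fun x V => inner ℝ V.2.1 (u s x)) fun V => by fun_prop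
  have h3 : Integrable (fun x => (boxState l w x).1 * energyTestFunction (cutEOS σ η₁) ρ u θ s x) :=
    ip_integrable_boxFun w (G := fun x V => V.1 * energyTestFunction (cutEOS σ η₁) ρ u θ s x) fun V => by fun_prop
  have h4 : Integrable (fun x => (boxState l w x).1 *
      max a (min ((cutEOS σ η₁).s (boxState l w x).1
        (2 / 3 * ((boxState l w x).2.2 / (boxState l w x).1 -
          ‖(boxState l w x).2.1‖ ^ 2 / (2 * (boxState l w x).1 ^ 2)))) b) * θ s x) :=
    ip_integrable_boxFun w (G := fun x V => V.1 * max a (min ((cutEOS σ η₁).s V.1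
        (2 / 3 * (V.2.2 / V.1 - ‖V.2.1‖ ^ 2 / (2 * V.1 ^ 2)))) b) * θ s x) fun V => by fun_prop
  have h5 : Integrable (fun x => (cutEOS σ η₁).p (ρ s x) (θ s x)) := hp.integrable_of_hasCompactSupport
    (HasCompactSupport.of_compactSpace _)
  have hpt : ∀ x, clampedRelEnergy σ η₁ a b (ρ s x) (u s x) (θ s x) (boxState l w x) =
      (boxState l w x).2.2 - inner ℝ (boxState l w x).2.1 (u s x) +
        (boxState l w x).1 * energyTestFunction (cutEOS σ η₁) ρ u θ s x -
        (boxState l w x).1 * max a (min ((cutEOS σ η₁).s (boxState l w x).1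
          (2 / 3 * ((boxState l w x).2.2 / (boxState l w x).1 -
            ‖(boxState l w x).2.1‖ ^ 2 / (2 * (boxState l w x).1 ^ 2)))) b) * θ s x +
        (cutEOS σ η₁).p (ρ s x) (θ s x) := fun x => by
    rw [sx_clampedRelEnergy_box]; ring
  have hA2 : Integrable (fun x => (boxState l w x).2.2 - inner ℝ (boxState l w x).2.1 (u s x)) := h1.sub h2
  have hA3 : Integrable (fun x => (boxState l w x).2.2 - inner ℝ (boxState l w x).2.1 (u s x) +
      (boxState l w x).1 * energyTestFunction (cutEOS σ η₁) ρ u θ s x) := hA2.add h3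
  have hA4 : Integrable (fun x => (boxState l w x).2.2 - inner ℝ (boxState l w x).2.1 (u s x) +
      (boxState l w x).1 * energyTestFunction (cutEOS σ η₁) ρ u θ s x -
      (boxState l w x).1 * max a (min ((cutEOS σ η₁).s (boxState l w x).1
          (2 / 3 * ((boxState l w x).2.2 / (boxState l w x).1 -
            ‖(boxState l w x).2.1‖ ^ 2 / (2 * (boxState l w x).1 ^ 2)))) b) * θ s x) := hA3.sub h4
  unfold clampedRelEnergyObs
  rw [← hw]
  simp_rw [hpt]
  rw [integral_add hA4 h5, integral_sub hA3 h4, integral_add hA2 h3, integral_sub h1 h2]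


/-- **The four tested pieces combine to `∫ reducedRHS`** at a configuration `w` with pairwise distinct velocities and a time
`s ∈ [0,T)`: `−∫(K1 integrand) + ∫(continuity integrand with φ₁) − ∫(K2 integrand) + ∫∂ₜp_cut = ∫ reducedRHS dx`
(`rawRHS = −momI + contI − entI + pt = reducedRHS − div(pU)`, `∫ div(pU) = 0`); also the `x`-integrability of `reducedRHS`. -/
theorem sx_pieces_eq_reduced {N : ℕ} (w : Config (N + 1) (Fin 3) T3) (hdist : ∀ i j, i ≠ j → (w i).2 ≠ (w j).2)
    {l : ℝ} (hl : 0 < l) (a b : ℝ) {s : ℝ} (hs : s ∈ Ico 0 T) :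
    -(∫ x, (inner ℝ (boxState l w x).2.1 (Torus.timeDerivWithin (Ico 0 T) u s x) +
          (∑ i, ∑ j, (boxState l w x).2.1 i * (boxState l w x).2.1 j / (boxState l w x).1 *
            Torus.partialDeriv j (fun y => u s y i) x) +
          (boxState l w x).1 * (2 / 3 * ((boxState l w x).2.2 / (boxState l w x).1 -
            ‖(boxState l w x).2.1‖ ^ 2 / (2 * (boxState l w x).1 ^ 2))) *
              cutCompressibility η₁ ((boxState l w x).1 * σ ^ 3) * Torus.divergence (u s) x)) +
      (∫ x, ((boxState l w x).1 * Torus.timeDerivWithin (Ico 0 T) (energyTestFunction (cutEOS σ η₁) ρ u θ) s x +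
          inner ℝ (boxState l w x).2.1 (Torus.gradient (energyTestFunction (cutEOS σ η₁) ρ u θ s) x))) -
      (∫ x, ((boxState l w x).1 *
              max a (min ((cutEOS σ η₁).s (boxState l w x).1
                (2 / 3 * ((boxState l w x).2.2 / (boxState l w x).1 -
                  ‖(boxState l w x).2.1‖ ^ 2 / (2 * (boxState l w x).1 ^ 2)))) b) *
            Torus.timeDerivWithin (Ico 0 T) θ s x +
          max a (min ((cutEOS σ η₁).s (boxState l w x).1
                (2 / 3 * ((boxState l w x).2.2 / (boxState l w x).1 -
                  ‖(boxState l w x).2.1‖ ^ 2 / (2 * (boxState l w x).1 ^ 2)))) b) *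
            inner ℝ (boxState l w x).2.1 (Torus.gradient (θ s) x))) +
      (∫ x, (pdAt T ρ u θ (s, x)).pt (cutEOS σ η₁)) =
    ∫ x, reducedRHS (cutEOS σ η₁) (clamp a b) (pdAt T ρ u θ (s, x)) (dens (boxPhase (boxState l w x)))
      (ien (boxPhase (boxState l w x))) (mom (boxPhase (boxState l w x))) ∧
    Integrable (fun x => reducedRHS (cutEOS σ η₁) (clamp a b) (pdAt T ρ u θ (s, x)) (dens (boxPhase (boxState l w x)))
      (ien (boxPhase (boxState l w x))) (mom (boxPhase (boxState l w x)))) := by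
  obtain ⟨hI1, hI2, hI3, hI4, -⟩ := sx_integrable_pieces S w hl a b hs
  obtain ⟨Np, -, -, hIpt⟩ := sx_integrableOn_pt S hs
  have hI5 := hIpt s hs
  -- pointwise identification with the BF integrands
  have hpt : ∀ x,
      -(inner ℝ (boxState l w x).2.1 (Torus.timeDerivWithin (Ico 0 T) u s x) +
          (∑ i, ∑ j, (boxState l w x).2.1 i * (boxState l w x).2.1 j / (boxState l w x).1 *
            Torus.partialDeriv j (fun y => u s y i) x) +
          (boxState l w x).1 * (2 / 3 * ((boxState l w x).2.2 / (boxState l w x).1 -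
            ‖(boxState l w x).2.1‖ ^ 2 / (2 * (boxState l w x).1 ^ 2))) *
              cutCompressibility η₁ ((boxState l w x).1 * σ ^ 3) * Torus.divergence (u s) x) +
        ((boxState l w x).1 * Torus.timeDerivWithin (Ico 0 T) (energyTestFunction (cutEOS σ η₁) ρ u θ) s x +
          inner ℝ (boxState l w x).2.1 (Torus.gradient (energyTestFunction (cutEOS σ η₁) ρ u θ s) x)) -
        ((boxState l w x).1 *
              max a (min ((cutEOS σ η₁).s (boxState l w x).1
                (2 / 3 * ((boxState l w x).2.2 / (boxState l w x).1 -
                  ‖(boxState l w x).2.1‖ ^ 2 / (2 * (boxState l w x).1 ^ 2)))) b) *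
            Torus.timeDerivWithin (Ico 0 T) θ s x +
          max a (min ((cutEOS σ η₁).s (boxState l w x).1
                (2 / 3 * ((boxState l w x).2.2 / (boxState l w x).1 -
                  ‖(boxState l w x).2.1‖ ^ 2 / (2 * (boxState l w x).1 ^ 2)))) b) *
            inner ℝ (boxState l w x).2.1 (Torus.gradient (θ s) x)) +
        (pdAt T ρ u θ (s, x)).pt (cutEOS σ η₁) =
      reducedRHS (cutEOS σ η₁) (clamp a b) (pdAt T ρ u θ (s, x)) (dens (boxPhase (boxState l w x)))
          (ien (boxPhase (boxState l w x))) (mom (boxPhase (boxState l w x))) -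
        ((cutEOS σ η₁).p (pdAt T ρ u θ (s, x)).r (pdAt T ρ u θ (s, x)).Θ * (pdAt T ρ u θ (s, x)).divU +
          ∑ j, (pdAt T ρ u θ (s, x)).U j * (pdAt T ρ u θ (s, x)).gp (cutEOS σ η₁) j) := by
    intro x
    obtain ⟨hφt, hφg⟩ := sx_energyTest_derivs S hs x
    rw [sx_momI_box s x (boxState l w x), sx_contI_box hφt hφg (boxState l w x), sx_entI_box a b s x (boxState l w x),
      ← rawRHS_eq_pieces]
    obtain ⟨hr, -, -⟩ := sx_band S hs x
    obtain ⟨-, hmom, -⟩ := sx_pd_eqs S hs x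
    have hvac := (co_box_admissible hl.le w hdist x).2.1
    have key := sx_rawRHS_add_div (σ := σ) (η₁ := η₁) (clamp a b) (d := pdAt T ρ u θ (s, x)) hr.ne' hmom (boxState l w x) hvac
    linarith
  have hdiv0 := sx_div_zero S hs
  -- integrate
  have hL : Integrable (fun x =>
      -(inner ℝ (boxState l w x).2.1 (Torus.timeDerivWithin (Ico 0 T) u s x) +
          (∑ i, ∑ j, (boxState l w x).2.1 i * (boxState l w x).2.1 j / (boxState l w x).1 *
            Torus.partialDeriv j (fun y => u s y i) x) +
          (boxState l w x).1 * (2 / 3 * ((boxState l w x).2.2 / (boxState l w x).1 -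
            ‖(boxState l w x).2.1‖ ^ 2 / (2 * (boxState l w x).1 ^ 2))) *
              cutCompressibility η₁ ((boxState l w x).1 * σ ^ 3) * Torus.divergence (u s) x) +
        ((boxState l w x).1 * Torus.timeDerivWithin (Ico 0 T) (energyTestFunction (cutEOS σ η₁) ρ u θ) s x +
          inner ℝ (boxState l w x).2.1 (Torus.gradient (energyTestFunction (cutEOS σ η₁) ρ u θ s) x)) -
        ((boxState l w x).1 *
              max a (min ((cutEOS σ η₁).s (boxState l w x).1
                (2 / 3 * ((boxState l w x).2.2 / (boxState l w x).1 -
                  ‖(boxState l w x).2.1‖ ^ 2 / (2 * (boxState l w x).1 ^ 2)))) b) *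
            Torus.timeDerivWithin (Ico 0 T) θ s x +
          max a (min ((cutEOS σ η₁).s (boxState l w x).1
                (2 / 3 * ((boxState l w x).2.2 / (boxState l w x).1 -
                  ‖(boxState l w x).2.1‖ ^ 2 / (2 * (boxState l w x).1 ^ 2)))) b) *
            inner ℝ (boxState l w x).2.1 (Torus.gradient (θ s) x)) +
        (pdAt T ρ u θ (s, x)).pt (cutEOS σ η₁)) := ((hI1.neg.add hI3).sub hI2).add hI5
  have hR : Integrable (fun x =>
      reducedRHS (cutEOS σ η₁) (clamp a b) (pdAt T ρ u θ (s, x)) (dens (boxPhase (boxState l w x)))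
          (ien (boxPhase (boxState l w x))) (mom (boxPhase (boxState l w x)))) := by
    have := hL.add hI4
    refine this.congr (Eventually.of_forall fun x => ?_)
    simp only [Pi.add_apply]
    rw [hpt x]
    ring
  have hA1 : Integrable (fun x =>
      -(inner ℝ (boxState l w x).2.1 (Torus.timeDerivWithin (Ico 0 T) u s x) +
          (∑ i, ∑ j, (boxState l w x).2.1 i * (boxState l w x).2.1 j / (boxState l w x).1 *
            Torus.partialDeriv j (fun y => u s y i) x) +
          (boxState l w x).1 * (2 / 3 * ((boxState l w x).2.2 / (boxState l w x).1 -
            ‖(boxState l w x).2.1‖ ^ 2 / (2 * (boxState l w x).1 ^ 2))) *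
              cutCompressibility η₁ ((boxState l w x).1 * σ ^ 3) * Torus.divergence (u s) x)) := hI1.neg
  have hA2 : Integrable (fun x =>
      -(inner ℝ (boxState l w x).2.1 (Torus.timeDerivWithin (Ico 0 T) u s x) +
          (∑ i, ∑ j, (boxState l w x).2.1 i * (boxState l w x).2.1 j / (boxState l w x).1 *
            Torus.partialDeriv j (fun y => u s y i) x) +
          (boxState l w x).1 * (2 / 3 * ((boxState l w x).2.2 / (boxState l w x).1 -
            ‖(boxState l w x).2.1‖ ^ 2 / (2 * (boxState l w x).1 ^ 2))) *
              cutCompressibility η₁ ((boxState l w x).1 * σ ^ 3) * Torus.divergence (u s) x) +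
        ((boxState l w x).1 * Torus.timeDerivWithin (Ico 0 T) (energyTestFunction (cutEOS σ η₁) ρ u θ) s x +
          inner ℝ (boxState l w x).2.1 (Torus.gradient (energyTestFunction (cutEOS σ η₁) ρ u θ s) x))) := hA1.add hI3
  have hA3 : Integrable (fun x =>
      -(inner ℝ (boxState l w x).2.1 (Torus.timeDerivWithin (Ico 0 T) u s x) +
          (∑ i, ∑ j, (boxState l w x).2.1 i * (boxState l w x).2.1 j / (boxState l w x).1 *
            Torus.partialDeriv j (fun y => u s y i) x) +
          (boxState l w x).1 * (2 / 3 * ((boxState l w x).2.2 / (boxState l w x).1 -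
            ‖(boxState l w x).2.1‖ ^ 2 / (2 * (boxState l w x).1 ^ 2))) *
              cutCompressibility η₁ ((boxState l w x).1 * σ ^ 3) * Torus.divergence (u s) x) +
        ((boxState l w x).1 * Torus.timeDerivWithin (Ico 0 T) (energyTestFunction (cutEOS σ η₁) ρ u θ) s x +
          inner ℝ (boxState l w x).2.1 (Torus.gradient (energyTestFunction (cutEOS σ η₁) ρ u θ s) x)) -
        ((boxState l w x).1 *
              max a (min ((cutEOS σ η₁).s (boxState l w x).1
                (2 / 3 * ((boxState l w x).2.2 / (boxState l w x).1 -
                  ‖(boxState l w x).2.1‖ ^ 2 / (2 * (boxState l w x).1 ^ 2)))) b) *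
            Torus.timeDerivWithin (Ico 0 T) θ s x +
          max a (min ((cutEOS σ η₁).s (boxState l w x).1
                (2 / 3 * ((boxState l w x).2.2 / (boxState l w x).1 -
                  ‖(boxState l w x).2.1‖ ^ 2 / (2 * (boxState l w x).1 ^ 2)))) b) *
            inner ℝ (boxState l w x).2.1 (Torus.gradient (θ s) x))) := hA2.sub hI2
  refine ⟨?_, hR⟩
  calc _ = ∫ x, (-(inner ℝ (boxState l w x).2.1 (Torus.timeDerivWithin (Ico 0 T) u s x) +
          (∑ i, ∑ j, (boxState l w x).2.1 i * (boxState l w x).2.1 j / (boxState l w x).1 *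
            Torus.partialDeriv j (fun y => u s y i) x) +
          (boxState l w x).1 * (2 / 3 * ((boxState l w x).2.2 / (boxState l w x).1 -
            ‖(boxState l w x).2.1‖ ^ 2 / (2 * (boxState l w x).1 ^ 2))) *
              cutCompressibility η₁ ((boxState l w x).1 * σ ^ 3) * Torus.divergence (u s) x) +
        ((boxState l w x).1 * Torus.timeDerivWithin (Ico 0 T) (energyTestFunction (cutEOS σ η₁) ρ u θ) s x +
          inner ℝ (boxState l w x).2.1 (Torus.gradient (energyTestFunction (cutEOS σ η₁) ρ u θ s) x)) -
        ((boxState l w x).1 *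
              max a (min ((cutEOS σ η₁).s (boxState l w x).1
                (2 / 3 * ((boxState l w x).2.2 / (boxState l w x).1 -
                  ‖(boxState l w x).2.1‖ ^ 2 / (2 * (boxState l w x).1 ^ 2)))) b) *
            Torus.timeDerivWithin (Ico 0 T) θ s x +
          max a (min ((cutEOS σ η₁).s (boxState l w x).1
                (2 / 3 * ((boxState l w x).2.2 / (boxState l w x).1 -
                  ‖(boxState l w x).2.1‖ ^ 2 / (2 * (boxState l w x).1 ^ 2)))) b) *
            inner ℝ (boxState l w x).2.1 (Torus.gradient (θ s) x)) +
        (pdAt T ρ u θ (s, x)).pt (cutEOS σ η₁)) := by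
          rw [integral_add hA3 hI5, integral_sub hA2 hI2, integral_add hA1 hI3, integral_neg]
    _ = ∫ x, (reducedRHS (cutEOS σ η₁) (clamp a b) (pdAt T ρ u θ (s, x)) (dens (boxPhase (boxState l w x)))
          (ien (boxPhase (boxState l w x))) (mom (boxPhase (boxState l w x))) -
        ((cutEOS σ η₁).p (pdAt T ρ u θ (s, x)).r (pdAt T ρ u θ (s, x)).Θ * (pdAt T ρ u θ (s, x)).divU +
          ∑ j, (pdAt T ρ u θ (s, x)).U j * (pdAt T ρ u θ (s, x)).gp (cutEOS σ η₁) j)) :=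
          integral_congr_ae (Eventually.of_forall hpt)
    _ = _ := by rw [integral_sub hR hI4, hdiv0, sub_zero]

/-- **The master inequality integrated over a configuration with distinct velocities** (`N` large: one-particle boxes have
density `((N+1)l³)⁻¹ ≤ ρs`): `∫ reducedRHS dx ≤ C · ∫ ℰ_Z dx`. -/
theorem sx_reduced_integral_le {N : ℕ} (w : Config (N + 1) (Fin 3) T3) (hdist : ∀ i j, i ≠ j → (w i).2 ≠ (w j).2)
    {l : ℝ} (hl : 0 < l) {a b C ρs s : ℝ} (hs : s ∈ Ico 0 T) (hρs : ((N : ℝ) + 1)⁻¹ * (l ^ 3)⁻¹ ≤ ρs)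
    (hmaster : ∀ (x : T3) (v : EulerPhase),
      (v = 0 ∨ (0 < dens v ∧ 0 < ien v) ∨ (0 < dens v ∧ ien v = 0 ∧ dens v ≤ ρs)) →
        reducedRHS (cutEOS σ η₁) (clamp a b) (pdAt T ρ u θ (s, x)) (dens v) (ien v) (mom v) ≤
          C * (pdAt T ρ u θ (s, x)).relEnergyZ (cutEOS σ η₁) (clamp a b) v) :
    ∫ x, reducedRHS (cutEOS σ η₁) (clamp a b) (pdAt T ρ u θ (s, x)) (dens (boxPhase (boxState l w x)))
        (ien (boxPhase (boxState l w x))) (mom (boxPhase (boxState l w x))) ≤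
      C * ∫ x, clampedRelEnergy σ η₁ a b (ρ s x) (u s x) (θ s x) (boxState l w x) := by
  rw [← integral_const_mul]
  refine integral_mono (sx_pieces_eq_reduced S w hdist hl a b hs).2
    (((sx_integrable_pieces S w hl a b hs).2.2.2.2).const_mul C) fun x => ?_
  · obtain ⟨h0, hvac, hien, hfro⟩ := co_box_admissible hl.le w hdist x
    show _ ≤ C * clampedRelEnergy σ η₁ a b (ρ s x) (u s x) (θ s x) (boxState l w x)
    rw [sx_clampedRelEnergy_eq_pdAt]
    refine hmaster x (boxPhase (boxState l w x)) ?_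
    rcases eq_or_lt_of_le h0 with h00 | hpos
    · left
      obtain ⟨hm, hE⟩ := hvac h00.symm
      simp only [boxPhase, ← h00, hm, hE]
      simp
    · rcases eq_or_lt_of_le hien with hE0 | hEpos
      · right; right
        exact ⟨hpos, hE0.symm, (hfro hpos hE0.symm).trans hρs⟩
      · right; left
        exact ⟨hpos, hEpos⟩


end Pathwise

end Summit.AtomisticToContinuum.HydrodynamicLimit.Theorems.RES

end
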